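/- Copyright: ym-fleet seat `ym-infvol-p3` (prover, g4), for crux `HistoryTail` (stmt-QuantumFields-18916) of route
`UnitScaleTilt`, STUB 3 «chessboard ∕ reflection positivity» of the v5′ skeleton.  Released under the licence of the
surrounding project. -/
import Summits.QuantumFields.YangMills.Theorems.UnitScaleTiltHistoryTailChessboardFamily
import Literature.MathematicalPhysics.QuantumFieldTheory.Balaban1983to89.T3UnitScaleTilt
import Literature.MathematicalPhysics.QuantumFieldTheory.Balaban1983to89.T3UnitLawDensityEML

/-!
# Chessboard for ONE averaged-plaquette event: the 3-d family of `HistoryTail` (STUB 3's statement)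

Support file (`--supports stmt-QuantumFields-18916`) for STUB 3 `stub_chessboardRP` of the v5′ birth skeleton of crux
`HistoryTail` (route `UnitScaleTilt`; text PROPOSED by the fleet lead ★ym-ust-18916-p1 g2, `birth_v5p_18916_proposal.lean`
064c15926725cd98, preferred by the owner's ADDENDUM 2 and awaiting registration).  **`chessboardRP_T3` below has the
PROPOSED statement of `stub_chessboardRP` VERBATIM** (so the registered stub, if unchanged, closes by `exact`): for every
cut-off `K`, height `j ≤ K`, threshold `θ`, separation `ρ ≥ 1` and level-`j` plaquette `p` there is a finite family
`S ∋ p` of level-`j` plaquettes, pairwise `ρ`-separated in the `ℓ¹` torus distance of base points, numerous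
(`sitesPerDir(j)³ ≤ |S|·8(L(ρ+4))³`), with `Gibbs_K(E′(p)) ≤ Gibbs_K(⋂_{q∈S} E′(q))^{1∕|S|}` for the events
`E′(q) = {θ ≤ dist1 Ū^j(∂q)}` of the `j`-fold (0.4)-averaged field.

PROOF.  File 4's `exists_separated_mirror_family` for `P := F.P K` (`d = 3`), the constant averaging `ℰp`, `B := Ici θ`,
cells of side `M := L^s` with `s` the least exponent with `ρ + 4 < L^s` (so `M − 1 ≥ ρ` and, by minimality,
`M ≤ L(ρ + 4)`), `N := 2L^{m+K−j−s}` cells per direction when `s ≤ m + K − j`; `S` := the image of the mirror family,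
`|S| = N³`; when the cells exceed the torus, `S := {p}` and the count clause still holds.  The reflection positivity is
the tree's (T⁴ cell's History chessboard road, Osterwalder–Seiler transported), files 1–4 the bookkeeping.

HONEST SCOPE.  A soft finite-torus statement; nothing of Bałaban's estimates; the crux `HistoryTail` and route
`UnitScaleTilt` stay CONDITIONAL on the (α) input package (STUBS 1, 2, 4, 5 of v5′).  Not infinite volume, not a gap,
not Clay.
-/

namespace Summit.QuantumFields.YangMills.Theorems.HistoryTailChessboardT3

open MeasureTheory Finset
open Literature.Barriers.CriticalPhenomena.NonGibbs
open Literature.MathematicalPhysics.QuantumFieldTheory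
open Literature.MathematicalPhysics.QuantumFieldTheory.Balaban1983to89
open Literature.MathematicalPhysics.QuantumFieldTheory.Balaban1983to89.T3ContinuumYM3Torus
open Literature.MathematicalPhysics.QuantumFieldTheory.Balaban1983to89.T3UnitScaleTilt
open Literature.MathematicalPhysics.QuantumFieldTheory.Balaban1983to89.T3UnitLawDensityEML
open Summit.QuantumFields.YangMills.Theorems.HistoryTailChessboardFamily

noncomputable section

/-- the site count of the `K`-th 3-d approximation at level `j` (all `Params` fields of `F.P K` are definitional).
[folklore] -/
theorem sitesPerDir_eq (F : T3Family) (K j : ℕ) : (F.P K).sitesPerDir j = 2 * F.L ^ (F.m + K - j) := rfl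

/-- the number of cube indices of the 3-d cube torus with `N` cubes per direction is `N³`. [folklore] -/
theorem card_blockIdx (F : T3Family) (K N : ℕ) [NeZero N] : Fintype.card (BlockIdx (F.P K).d N) = N ^ 3 := by
  show Fintype.card (Fin (F.P K).d → ZMod N) = N ^ 3
  rw [Fintype.card_fun, ZMod.card, Fintype.card_fin]
  rfl

/-- **THE CHESSBOARD ESTIMATE FOR ONE AVERAGED-PLAQUETTE EVENT** — the PROPOSED text of STUB 3 `stub_chessboardRP` of
the v5′ skeleton of `HistoryTail`, verbatim, as a theorem (file 4's `exists_separated_mirror_family` on the 3-d family,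
cells of side `L^s`, `s` least with `ρ + 4 < L^s`). [folklore] -/
theorem chessboardRP_T3 :
    ∀ (L : ℕ), Odd L → 1 < L →
      ∀ (F : T3Family) (γ : ℝ), F.L = L → 0 < γ → γ ≤ 1 → ∀ (θ : ℝ) (K j : ℕ), j ≤ K → ∀ (ρ : ℝ), 1 ≤ ρ →
        ∀ p : Plaq (F.P K) j,
          ∃ S : Finset (Plaq (F.P K) j), p ∈ S ∧
            (∀ q ∈ S, ∀ q' ∈ S, q ≠ q' → ρ ≤ (Site.tdist q.src q'.src : ℝ)) ∧
            (((F.P K).sitesPerDir j : ℝ) ^ 3 ≤ (S.card : ℝ) * (8 * ((F.L : ℝ) * (ρ + 4)) ^ 3)) ∧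
            (gibbsK F ℰp γ K).real
                {U | θ ≤ GaugeGroup.dist1 (GaugeField.plaqHol
                  (Averaging.iter (fun _ => BlockAveraging.blockAvg ℰp) j U) p)} ≤
              ((gibbsK F ℰp γ K).real
                {U | ∀ q ∈ S, θ ≤ GaugeGroup.dist1 (GaugeField.plaqHol
                  (Averaging.iter (fun _ => BlockAveraging.blockAvg ℰp) j U) q)}) ^ ((1 : ℝ) / (S.card : ℝ)) := by
  intro L _hLodd hL1 F γ hFL hγ _hγ1 θ K j hjK ρ hρ p
  classical
  subst hFL
  -- the cell exponent: the least `s` with `ρ + 4 < L^s`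
  have hL1R : (1 : ℝ) < (F.L : ℝ) := by exact_mod_cast hL1
  have hex : ∃ s : ℕ, ρ + 4 < (F.L : ℝ) ^ s := pow_unbounded_of_one_lt (ρ + 4) hL1R
  set s := Nat.find hex with hs_def
  have hs : ρ + 4 < (F.L : ℝ) ^ s := Nat.find_spec hex
  have hs1 : 1 ≤ s := by
    by_contra h0
    have h0' : s = 0 := by omega
    rw [h0', pow_zero] at hs
    linarith
  have hmin : (F.L : ℝ) ^ (s - 1) ≤ ρ + 4 := by
    have := Nat.find_min hex (show s - 1 < Nat.find hex by omega)
    exact not_lt.1 this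
  have hLpos : (0 : ℝ) < F.L := by linarith
  -- `L^s ≤ L (ρ + 4)`
  have hMle : ((F.L ^ s : ℕ) : ℝ) ≤ (F.L : ℝ) * (ρ + 4) := by
    have e : ((F.L ^ s : ℕ) : ℝ) = (F.L : ℝ) * (F.L : ℝ) ^ (s - 1) := by
      rw [Nat.cast_pow, ← pow_succ', Nat.sub_add_cancel hs1]
    rw [e]
    exact mul_le_mul_of_nonneg_left hmin hLpos.le
  -- the event set in file 4's currency
  have hβ : 0 ≤ (F.scheme ℰp γ).β K := F.scheme_β_nonneg ℰp hγ.le K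
  by_cases hfit : s ≤ F.m + K - j
  · -- the cells fit in the torus: `M := L^s`, `N := 2·L^{m+K−j−s}`
    set t : ℕ := F.m + K - j - s with ht_def
    set M : ℕ := F.L ^ s with hM_def
    set N : ℕ := 2 * F.L ^ t with hN_def
    haveI : NeZero N := ⟨by rw [hN_def]; positivity⟩
    have hN : Even N := ⟨F.L ^ t, by rw [hN_def]; ring⟩
    have hst : F.m + K - j = s + t := by omega
    have h : (F.P K).sitesPerDir j = M * N := by
      rw [sitesPerDir_eq, hst, pow_add, hM_def, hN_def]
      ring
    have hM2 : 2 ≤ M := by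
      rw [hM_def]
      calc 2 ≤ F.L := hL1
        _ = F.L ^ 1 := (pow_one _).symm
        _ ≤ F.L ^ s := Nat.pow_le_pow_right (by omega) hs1
    have hK : j ≤ (F.P K).m + (F.P K).K := by show j ≤ F.m + K; omega
    obtain ⟨q, hinj, ⟨c₀, hc₀⟩, -, hsep, hbound⟩ :=
      exists_separated_mirror_family (F.P K) hβ (fun _ => ℰp) (fun _ l => measurableE_ℰp l) j hK h hN hM2
        (measurableSet_Ici (a := θ)) p
    refine ⟨univ.image q, mem_image.2 ⟨c₀, mem_univ _, hc₀⟩, ?_, ?_, ?_⟩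
    · -- pairwise separation
      intro q₁ hq₁ q₂ hq₂ hne
      obtain ⟨c₁, -, rfl⟩ := mem_image.1 hq₁
      obtain ⟨c₂, -, rfl⟩ := mem_image.1 hq₂
      have hc : c₁ ≠ c₂ := fun e => hne (by rw [e])
      have h1 := hsep c₁ c₂ hc
      have hMR : ρ ≤ ((M - 1 : ℕ) : ℝ) := by
        rw [Nat.cast_sub (by omega : 1 ≤ M), Nat.cast_one, hM_def, Nat.cast_pow]
        linarith
      exact hMR.trans (by exact_mod_cast h1)
    · -- the count
      have hcard : (univ.image q).card = N ^ 3 := by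
        rw [card_image_of_injective _ hinj, card_univ, card_blockIdx]
      rw [hcard, h]
      push_cast
      have hM0 : (0 : ℝ) ≤ (M : ℝ) := Nat.cast_nonneg _
      have hM' : (M : ℝ) ≤ 2 * ((F.L : ℝ) * (ρ + 4)) := by
        have : (M : ℝ) ≤ (F.L : ℝ) * (ρ + 4) := by rw [hM_def]; exact hMle
        nlinarith
      have hN0 : (0 : ℝ) ≤ (N : ℝ) ^ 3 := by positivity
      calc ((M : ℝ) * N) ^ 3 = (N : ℝ) ^ 3 * (M : ℝ) ^ 3 := by ring
        _ ≤ (N : ℝ) ^ 3 * (2 * ((F.L : ℝ) * (ρ + 4))) ^ 3 :=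
            mul_le_mul_of_nonneg_left (pow_le_pow_left₀ hM0 hM' 3) hN0
        _ = (N : ℝ) ^ 3 * (8 * ((F.L : ℝ) * (ρ + 4)) ^ 3) := by ring
    · -- the estimate
      have hcard : ((univ.image q).card : ℝ) = (N : ℝ) ^ (F.P K).d := by
        rw [card_image_of_injective _ hinj, card_univ, card_blockIdx]
        push_cast
        rfl
      have eS : {U : GaugeField (F.P K) 0 (Matrix.specialUnitaryGroup (Fin 2) ℂ) |
          ∀ q' ∈ univ.image q, θ ≤ GaugeGroup.dist1 (GaugeField.plaqHol
            (Averaging.iter (fun _ => BlockAveraging.blockAvg ℰp) j U) q')} =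
          {U | ∀ c : BlockIdx (F.P K).d N, GaugeGroup.dist1 (GaugeField.plaqHol
            (Averaging.iter (fun k => BlockAveraging.blockAvg (P := F.P K) (j := k) ((fun _ => ℰp) k)) j U) (q c)) ∈
              Set.Ici θ} := by
        ext U
        simp only [Set.mem_setOf_eq, mem_image, mem_univ, true_and, forall_exists_index, forall_apply_eq_imp_iff,
          Set.mem_Ici]
      rw [hcard, gibbsK_eq, eS]
      exact hbound
  · -- the cells exceed the torus: `S := {p}`
    refine ⟨{p}, mem_singleton_self p, ?_, ?_, ?_⟩
    · intro q hq q' hq' hne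
      rw [mem_singleton] at hq hq'
      exact absurd (hq.trans hq'.symm) hne
    · rw [card_singleton, Nat.cast_one, one_mul, sitesPerDir_eq]
      push_cast
      have hle : (F.L : ℝ) ^ (F.m + K - j) ≤ ρ + 4 := by
        calc (F.L : ℝ) ^ (F.m + K - j) ≤ (F.L : ℝ) ^ (s - 1) := pow_le_pow_right₀ hL1R.le (by omega)
          _ ≤ ρ + 4 := hmin
      have h0 : (0 : ℝ) ≤ 2 * (F.L : ℝ) ^ (F.m + K - j) := by positivity
      have h1 : 2 * (F.L : ℝ) ^ (F.m + K - j) ≤ 2 * ((F.L : ℝ) * (ρ + 4)) := by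
        have : ρ + 4 ≤ (F.L : ℝ) * (ρ + 4) := by nlinarith
        linarith
      calc (2 * (F.L : ℝ) ^ (F.m + K - j)) ^ 3 ≤ (2 * ((F.L : ℝ) * (ρ + 4))) ^ 3 := pow_le_pow_left₀ h0 h1 3
        _ = 8 * ((F.L : ℝ) * (ρ + 4)) ^ 3 := by ring
    · rw [card_singleton, Nat.cast_one, div_one, Real.rpow_one]
      simp only [mem_singleton, forall_eq]
      exact le_rfl

end

end Summit.QuantumFields.YangMills.Theorems.HistoryTailChessboardT3
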